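import Summits.CriticalPhenomena.SAWScalingLimit.Theorems.SAWTrackTransportYBtoUniformSummitEquivalent
import Summits.CriticalPhenomena.SAWScalingLimit.Theorems.SAWCompassLatticeSurfaceUniversalityGlueV6
import Summits.CriticalPhenomena.SAWScalingLimit.Theorems.SAWCompassLatticeSurfaceUniversalityTightZ2
import Summits.CriticalPhenomena.SAWScalingLimit.Theorems.EventualTight.Negative.TightnessNecessary

/-!
# The KERNEL of `YBtoUniform` (stmt-CriticalPhenomena-16966) is, inside the route, the summit conjunct

Crux-strategist r1 (redirect, second opinion) census fact for the crux
`Summit.CriticalPhenomena.SAWScalingLimit.Theses.SAWTrackTransport.YBtoUniform` (route `SAWTrackTransport`, rank 6).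

The first strategist (b1) showed, and a prover landed (p155401,
`Theorems/SAWTrackTransportYBtoUniformSummitEquivalent.lean`), that INSIDE ITS ROUTE the toll
`YBtoUniform` is equivalent to the sub-problem statement `SAWScalingLimit`. Since then the lead of the
sibling crux stmt-6964 landed the consensus route-level split of the toll
(`Theorems/SAWCompassLatticeSurfaceUniversalityGlueV6.lean`):

  `glue_ybToUniform_of_research : SAWParafermion.EventualTight → LipApproxIndependence → LipUnifToYB → YBtoUniform`

with `EventualTight` = the shared tightness item stmt-1881 (⟺ stmt-1372), `LipApproxIndependence` =
independence of the lattice approximation for the critical `ℤ²` walk at bounded-Lipschitz level (one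
model; `@[conjecture]`, `…SurfaceUniversalityApproxDefs.lean`) and `LipUnifToYB` = THE KERNEL (the uniform
point `fwLaw x_c x_c x_c 0 0` versus Glazman–Manolescu's integrable point `ybLaw (π/2)` of ONE face-weight
family on ONE walk space, bounded-Lipschitz merging; `@[conjecture]`, `…SurfaceUniversalityDefs.lean`).

This file records, sorry-free, what that split does and does not buy (the redirect test "no piece ↔
summit" ONE LEVEL DOWN):

* `eventualTight_of_sawScalingLimit'` — the tightness child is a CONSEQUENCE of the conjunct
  (`SAWScalingLimit → SAWParafermion.EventualTight`; Prokhorov/Ulam on the Polish space `CurveClass ℂ`,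
  tree theorems `exists_isTightMeasureSet_image_of_convergesInLawToSLE` + `eventualTight_of_renewal`).
* `lipUnifToYB_of_ybToUniform` — given the conventions child `LipApproxIndependence`, the toll gives the
  kernel back (`lipUnifToYB_of_lipYBtoUniform`, the PROVED plus dictionary `lipPlusIsUnif`).
* `lipUnifToYB_iff_ybToUniform` — hence, given the two one-model children, **kernel ↔ toll**.
* `sawScalingLimit_iff_tight_and_kernel` — given `YBSquareSLE` (stmt-6967) and `LipApproxIndependence`:
  **`SAWScalingLimit ↔ (EventualTight ∧ LipUnifToYB)`**; and its in-route form
  `sawScalingLimit_iff_tight_and_kernel_in_route` from the five other cruxes of `SAWTrackTransport`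
  (through the landed `ybSquareSLE_of_trackTransport`).
* `lipUnifToYB_iff_sawScalingLimit_in_route` — so the hard child of the consensus split is, inside the
  route and given the two one-model children, LITERALLY the summit conjunct: the split moves the
  `summit_equivalent` flag one level down without changing its nature. The kernel is the route's RESIDUAL
  (conjunct-split provision of D-0033), shared with stmt-6964.

No new hypothesis, no new definition; axioms propext / Classical.choice / Quot.sound.
-/

noncomputable section

namespace Summit.CriticalPhenomena.SAWScalingLimit.Cruxes.YBtoUniform.KernelSummitEquivalent

open Summit.CriticalPhenomena.SAWScalingLimit.Theses
open Summit.CriticalPhenomena.SAWScalingLimit.Theses.SAWTrackTransport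
open Summit.CriticalPhenomena.SAWScalingLimit.Theorems.SurfaceUniversality
open Summit.CriticalPhenomena.SAWScalingLimit.Theorems.YBtoUniform.SummitEquivalent
  (ybToUniform_iff_sawScalingLimit_of_trackTransport ybToUniform_iff_sawScalingLimit)
open Summit.CriticalPhenomena.SAWScalingLimit.Theorems (SAWCompassLatticeCompassSLE.ybSquareSLE_of_trackTransport)

/-- **The tightness child is necessary for the conjunct**: `SAWScalingLimit → SAWParafermion.EventualTight`
(stmt-1881): convergence in law to chordal SLE(8/3) along `𝓝[>] 0` gives a tight image set on some
`(0, δ₀]` (Ulam tightness of the limit law on the Polish space `CurveClass ℂ`, tree theorem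
`EventualTight.Negative.exists_isTightMeasureSet_image_of_convergesInLawToSLE`), and the set form is the
mesh form (`eventualTight_of_renewal`). Billingsley, Convergence of Probability Measures, Thm 5.1–5.2.
[folklore] -/
theorem eventualTight_of_sawScalingLimit' (hS : _root_.SAWScalingLimit) : SAWParafermion.EventualTight :=
  eventualTight_of_renewal fun D a b hab =>
    Summit.CriticalPhenomena.SAWScalingLimit.Theorems.EventualTight.Negative.exists_isTightMeasureSet_image_of_convergesInLawToSLE
      hab (hS D a b hab)

/-- **Children ⇒ toll** — the landed consensus glue, re-exported under this crux's name:
`EventualTight → LipApproxIndependence → LipUnifToYB → YBtoUniform`. [folklore] -/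
theorem ybToUniform_of_children :
    SAWParafermion.EventualTight → LipApproxIndependence → LipUnifToYB → YBtoUniform :=
  GlueV6.glue_ybToUniform_of_research

/-- **Toll ⇒ kernel, given the conventions child**: `LipApproxIndependence → YBtoUniform → LipUnifToYB`
(`∫dUnif − ∫dYB = (∫dP^{ℤ²} − ∫dYB) − (∫dP^{ℤ²} − ∫dPlus) − (∫dPlus − ∫dUnif)`: the toll at Lipschitz
level, the conventions leg `LipPlusPointIsZ2 ⇐ LipApproxIndependence` (landed v6 glue) and the PROVED
plus dictionary `lipPlusIsUnif`). [folklore] -/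
theorem lipUnifToYB_of_ybToUniform (hA : LipApproxIndependence) (h : YBtoUniform) : LipUnifToYB :=
  lipUnifToYB_of_lipYBtoUniform (lipYBtoUniform_of_ybToUniform h)
    (GlueV6.glue_lipPlusPointIsZ2_of_approx hA) lipPlusIsUnif

/-- **Kernel ↔ toll, given the two one-model children** (tightness stmt-1881 and approximation
independence). [folklore] -/
theorem lipUnifToYB_iff_ybToUniform (hT : SAWParafermion.EventualTight) (hA : LipApproxIndependence) :
    LipUnifToYB ↔ YBtoUniform :=
  ⟨GlueV6.glue_ybToUniform_of_research hT hA, lipUnifToYB_of_ybToUniform hA⟩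

/-- **Given `YBSquareSLE` (stmt-6967) and the conventions child, the conjunct IS "tightness ∧ kernel"**:
`SAWScalingLimit ↔ (SAWParafermion.EventualTight ∧ LipUnifToYB)`. [folklore] -/
theorem sawScalingLimit_iff_tight_and_kernel (hY : SAWCompassLattice.YBSquareSLE)
    (hA : LipApproxIndependence) :
    _root_.SAWScalingLimit ↔ (SAWParafermion.EventualTight ∧ LipUnifToYB) := by
  constructor
  · intro hS
    exact ⟨eventualTight_of_sawScalingLimit' hS,
      lipUnifToYB_of_ybToUniform hA ((ybToUniform_iff_sawScalingLimit hY).2 hS)⟩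
  · rintro ⟨hT, hK⟩
    exact (ybToUniform_iff_sawScalingLimit hY).1 (GlueV6.glue_ybToUniform_of_research hT hA hK)

/-- **Given `YBSquareSLE`, tightness and the conventions child, the kernel IS the conjunct**:
`LipUnifToYB ↔ SAWScalingLimit`. [folklore] -/
theorem lipUnifToYB_iff_sawScalingLimit (hY : SAWCompassLattice.YBSquareSLE)
    (hT : SAWParafermion.EventualTight) (hA : LipApproxIndependence) :
    LipUnifToYB ↔ _root_.SAWScalingLimit :=
  (lipUnifToYB_iff_ybToUniform hT hA).trans (ybToUniform_iff_sawScalingLimit hY)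

/-- **In-route form**: given the five other cruxes of route `SAWTrackTransport` (which supply
`YBSquareSLE`, landed `ybSquareSLE_of_trackTransport`) and the conventions child,
`SAWScalingLimit ↔ (EventualTight ∧ LipUnifToYB)`. [folklore] -/
theorem sawScalingLimit_iff_tight_and_kernel_in_route (h₂ : AngleUniversality) (h₃ : YBLimitExists)
    (h₄ : AxiomsOfLimit) (h₅ : RStarRot) (h₇ : MirrorRotation) (hA : LipApproxIndependence) :
    _root_.SAWScalingLimit ↔ (SAWParafermion.EventualTight ∧ LipUnifToYB) :=
  sawScalingLimit_iff_tight_and_kernel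
    (SAWCompassLatticeCompassSLE.ybSquareSLE_of_trackTransport h₂ h₃ h₄ h₅ h₇) hA

/-- **In-route form for the kernel alone**: given the five other cruxes, tightness (stmt-1881) and
approximation independence, the kernel child `LipUnifToYB` of the consensus split is EQUIVALENT to the
sub-problem statement — the redirect test "no piece ↔ summit" fails one level down exactly as it failed
for the toll. [folklore] -/
theorem lipUnifToYB_iff_sawScalingLimit_in_route (h₂ : AngleUniversality) (h₃ : YBLimitExists)
    (h₄ : AxiomsOfLimit) (h₅ : RStarRot) (h₇ : MirrorRotation)
    (hT : SAWParafermion.EventualTight) (hA : LipApproxIndependence) :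
    LipUnifToYB ↔ _root_.SAWScalingLimit :=
  (lipUnifToYB_iff_ybToUniform hT hA).trans
    (ybToUniform_iff_sawScalingLimit_of_trackTransport h₂ h₃ h₄ h₅ h₇)

/-! ### One-line signatures (registrable as strategist stubs; a prover may land this file verbatim under
`Theorems/SAWTrackTransportYBtoUniformKernelSummitEquivalent.lean --supports stmt-CriticalPhenomena-16966`) -/

/-- `stub_summitGivesTight`. [folklore] -/
theorem stub_summitGivesTight : _root_.SAWScalingLimit → SAWParafermion.EventualTight :=
  eventualTight_of_sawScalingLimit'

/-- `stub_kernelIffTollGivenChildren`. [folklore] -/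
theorem stub_kernelIffTollGivenChildren : SAWParafermion.EventualTight → LipApproxIndependence → (LipUnifToYB ↔ SAWTrackTransport.YBtoUniform) :=
  lipUnifToYB_iff_ybToUniform

/-- `stub_summitIffTightAndKernel`. [folklore] -/
theorem stub_summitIffTightAndKernel : SAWCompassLattice.YBSquareSLE → LipApproxIndependence → (_root_.SAWScalingLimit ↔ (SAWParafermion.EventualTight ∧ LipUnifToYB)) :=
  sawScalingLimit_iff_tight_and_kernel

/-- `stub_kernelIffSummitInRoute`. [folklore] -/
theorem stub_kernelIffSummitInRoute : SAWTrackTransport.AngleUniversality → SAWTrackTransport.YBLimitExists → SAWTrackTransport.AxiomsOfLimit → SAWTrackTransport.RStarRot → SAWTrackTransport.MirrorRotation → SAWParafermion.EventualTight → LipApproxIndependence → (LipUnifToYB ↔ _root_.SAWScalingLimit) :=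
  lipUnifToYB_iff_sawScalingLimit_in_route

end Summit.CriticalPhenomena.SAWScalingLimit.Cruxes.YBtoUniform.KernelSummitEquivalent

end
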